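/-
Copyright (c) 2026 the pub-hodgecm-mathlib formalisation cell (harness21).  Prover seat hodgecm-mathlib-K2E3-p11 (g10), Track B «K2-LIT», #184♮ = hLiu418 =
`stmt-HodgeConjecture-24832`; socket #41, KIND W, (KW-arch-hBL) brick (3b) — KW desk F0P2-p08 (g4) RULING (KW-R5) 2026-09-05T01:18:48Z «(3b)
`K2LiuKindWArchIwasawaComparability` = K2E3-p11 GO».  THEOREMS ONLY (no `def`, no `instance`, no notation, no named-fact hypothesis, no `sorry`).
-/
import Summits.HodgeConjecture.HodgeConjecture.Theorems.K2LiuSiegelStabBlocks       -- ★ `inv_eq_fromBlocks`, `mem_unitaryGroup_of_stab` (+ ★ `K2LiuHermitianTubeDescend.isUnit_det_of_mem_UJ`)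
import Summits.HodgeConjecture.HodgeConjecture.Theorems.K2LiuArchBlockOfFrame         -- ★ FILE 10 `antidiag_letters` (the Levi `m₀ = diag(C, −B)` of the frame)
import Mathlib.Analysis.CStarAlgebra.Matrix                                           -- `entry_norm_bound_of_unitary`
import HarnessLib

/-!
# Crux `HLiu418`, socket #41, KIND W — `K2LiuKindWArchIwasawaComparability`: the Iwasawa reading of the (iii-arch) block vs the hermitian Levi letter of the (x-a) column

Cell `hodgecm-mathlib`, crux item hLiu418 = `stmt-HodgeConjecture-24832` (helper lane `--supports … --as helper`, count-neutral).  (KW-arch-hBL) brick (3b) of the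
census 2026-09-05T01:16:30Z (desk ruling (KW-R5)).  THE TWO CURRENCIES.  The growth letter `hBL` of ★ `K2LiuKindWBlockOfRecordCMOfLocalLettersHaar` reads the
archimedean part of `h` in the frame of record as `p · κ` with `p = (y b; 0 d)` block upper triangular and `κ` a bounded matrix with bounded inverse (`‖κ‖, ‖κ⁻¹‖ ≤ M`
entrywise), and wants growth in `(‖det y‖, t = Σ_{ab} ‖(yᴴ·HIDX·y)_{ab}‖, det(yᴴ·HIDX·y))`; the per-place growth letters of the (x-a) column (LH4-p08's FILE 2
`exists_twistedWhittaker_continuation_growth_of_posDef∕_of_negDef`, the «Φ6b-ind» organ's (R3)) speak of ANY hermitian Iwasawa decomposition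
`m₀ · P = n(X₀) · diag(R, R⁻¹) · u₀` of the translated point `P = p·κ·G` (`m₀ = diag(C, −B)` the Levi of the frame image `x = (0 B; C 0)` of `w_Δ`, `G = Fr(g) w ∈ U(J)` the
fixed ★ FILE 18 conjugator), in `(‖det R‖, T₂(R·h₁·R), det(R·h₁·R))`, `h₁ = C⁻ᴴ·hidx·C⁻¹`.
THE COMPARISON (pure block algebra — no Möbius action, no polar decomposition, no Iwasawa uniqueness): put `W := u₀·G⁻¹·κ⁻¹`; then
`n(X₀)·diag(R,R⁻¹)·W = m₀·p` is block upper triangular, so `W₂₁ = 0` and `γ := W₁₁ = R⁻¹·C·y`, i.e. **`C·y = R·γ`**, where `γ` and `γ⁻¹ = (κ·G·u₀ᴴ)₁₁` have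
entries `≤ m := 16·M·M_G` (`u₀ ∈ Stab(i1)` is unitary ★ `mem_unitaryGroup_of_stab`, Mathlib `entry_norm_bound_of_unitary`; `G⁻¹ = (G₂₂ᴴ −G₁₂ᴴ; −G₂₁ᴴ G₁₁ᴴ)` ★
`inv_eq_fromBlocks`).  Consequently (`R` hermitian) **`yᴴ·hidx·y = γᴴ·(R·h₁·R)·γ`** and
  `‖det C‖·‖det y‖ ≤ 2m²·‖det R‖`, `‖det R‖ ≤ 2m²·‖det C‖·‖det y‖`, `T₂(yᴴ hidx y) ≤ 4m²·T₂(R h₁ R)`, `T₂(R h₁ R) ≤ 4m²·T₂(yᴴ hidx y)`,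
  `‖det(yᴴ hidx y)‖ ≤ 4m⁴·‖det(R h₁ R)‖`, `‖det(R h₁ R)‖ ≤ 4m⁴·‖det(yᴴ hidx y)‖`
— the three two-sided conversions the assembler (3c) `hBL_of_placeGrowth` needs, with constants in `M, M_G` only.
* §1 entry bookkeeping on `Fin 2 ⊕ Fin 2` ∕ `Fin 2` (products, blocks, `2×2` determinants, the entrywise sum `T₂` under two-sided multiplication);
* §2 inverses: `U(J)` elements (entries of `G⁻¹` bounded by those of `G`), unitary `u₀` (entries of `u₀`, `u₀ᴴ` ≤ 1);
* §3 the letter `γ`: `C·y = R·γ` with `γ, γ⁻¹` bounded (`iwasawa_levi_reading`);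
* §4 HEAD `iwasawa_comparability` — the six inequalities.
References: [Shimura1997] §16.4, §18.1; [BorelJacquet1979] §4.1 (Iwasawa decomposition and heights).
HONEST LABEL.  Count-neutral helper; `hBL` stays BY VALUE at the tie until (3a) (3a′) (3c) + LH4-p08's FILE 2 + the organ land: `HC_CM` is proved only modulo the 7 printed
citations (2 remaining named inputs: hLiu418 = `stmt-HodgeConjecture-24832`, h413 = `stmt-HodgeConjecture-24833`) until rung 0 closes.
-/

set_option autoImplicit false
set_option linter.dupNamespace false -- the mandated namespace repeats `HodgeConjecture.HodgeConjecture`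

noncomputable section

open Complex Matrix
open scoped ComplexConjugate

namespace Summit.HodgeConjecture.HodgeConjecture.Cruxes.HLiu418.K2LiuKindWArchIwasawaComparability

open Literature.NumberTheory.ModularForms.SiegelUpperHalfSpace (moeb)
open Summit.HodgeConjecture.HodgeConjecture.Cruxes.HLiu418.K2LiuHermitianTubeDescend (isUnit_det_of_mem_UJ)
open Summit.HodgeConjecture.HodgeConjecture.Cruxes.HLiu418.K2LiuSiegelStabBlocks (inv_eq_fromBlocks mem_unitaryGroup_of_stab)
open Summit.HodgeConjecture.HodgeConjecture.Cruxes.HLiu418.K2LiuArchBlockOfFrame (antidiag_letters)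

/-! ## §1 Entry bookkeeping -/

/-- an entry bound is nonnegative. [folklore] -/
theorem nonneg_of_entry_bound {ι : Type*} {X : Matrix ι ι ℂ} {a : ℝ} (i : ι) (hX : ∀ i j, ‖X i j‖ ≤ a) : 0 ≤ a :=
  (norm_nonneg _).trans (hX i i)

/-- **entries of a product on `Fin 2 ⊕ Fin 2`**: `‖(X·Y)_{ij}‖ ≤ 4·a·b`. [folklore] -/
theorem norm_mul_apply_le_four {X Y : Matrix (Fin 2 ⊕ Fin 2) (Fin 2 ⊕ Fin 2) ℂ} {a b : ℝ} (hX : ∀ i j, ‖X i j‖ ≤ a) (hY : ∀ i j, ‖Y i j‖ ≤ b)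
    (i j : Fin 2 ⊕ Fin 2) : ‖(X * Y) i j‖ ≤ 4 * a * b := by
  have ha : 0 ≤ a := nonneg_of_entry_bound i hX
  rw [Matrix.mul_apply]
  refine (norm_sum_le _ _).trans ?_
  calc ∑ k, ‖X i k * Y k j‖ ≤ ∑ _k : Fin 2 ⊕ Fin 2, a * b := Finset.sum_le_sum fun k _ => by
          rw [norm_mul]; exact mul_le_mul (hX i k) (hY k j) (norm_nonneg _) ha
    _ = 4 * a * b := by simp [Finset.sum_const, Finset.card_univ]; ring

/-- entries of the `(1,1)` block are entries. [folklore] -/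
theorem norm_toBlocks₁₁_le {X : Matrix (Fin 2 ⊕ Fin 2) (Fin 2 ⊕ Fin 2) ℂ} {a : ℝ} (hX : ∀ i j, ‖X i j‖ ≤ a) (i j : Fin 2) : ‖X.toBlocks₁₁ i j‖ ≤ a :=
  hX (Sum.inl i) (Sum.inl j)

/-- **`2 × 2` determinant bound**: `‖det β‖ ≤ 2·m²` for entries `≤ m`. [folklore] -/
theorem norm_det_fin_two_le {β : Matrix (Fin 2) (Fin 2) ℂ} {m : ℝ} (hβ : ∀ i j, ‖β i j‖ ≤ m) : ‖β.det‖ ≤ 2 * m ^ 2 := by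
  have hm : 0 ≤ m := nonneg_of_entry_bound 0 hβ
  rw [Matrix.det_fin_two]
  refine (norm_sub_le _ _).trans ?_
  rw [norm_mul, norm_mul]
  nlinarith [hβ 0 0, hβ 0 1, hβ 1 0, hβ 1 1, norm_nonneg (β 0 0), norm_nonneg (β 0 1), norm_nonneg (β 1 0), norm_nonneg (β 1 1),
    mul_le_mul (hβ 0 0) (hβ 1 1) (norm_nonneg _) hm, mul_le_mul (hβ 0 1) (hβ 1 0) (norm_nonneg _) hm]

/-- **the entrywise sum under two-sided multiplication**: `T₂(P·X·Q) ≤ 4·m_P·m_Q·T₂(X)` on `2 × 2` matrices, `T₂(X) = Σ_{ab} ‖X_{ab}‖`. [folklore] -/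
theorem entrySum_mul_mul_le {P X Q : Matrix (Fin 2) (Fin 2) ℂ} {mP mQ : ℝ} (hP : ∀ i j, ‖P i j‖ ≤ mP) (hQ : ∀ i j, ‖Q i j‖ ≤ mQ) :
    ∑ a, ∑ b, ‖(P * X * Q) a b‖ ≤ 4 * mP * mQ * ∑ a, ∑ b, ‖X a b‖ := by
  have hmP : 0 ≤ mP := nonneg_of_entry_bound 0 hP
  have hmQ : 0 ≤ mQ := nonneg_of_entry_bound 0 hQ
  -- one entry: `‖(P X Q)_{ab}‖ ≤ mP · mQ · T₂(X)`
  have hentry : ∀ a b, ‖(P * X * Q) a b‖ ≤ mP * mQ * ∑ c, ∑ d, ‖X c d‖ := by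
    intro a b
    rw [Matrix.mul_apply]
    refine (norm_sum_le _ _).trans ?_
    have h1 : ∀ d, ‖(P * X) a d * Q d b‖ ≤ mQ * ∑ c, mP * ‖X c d‖ := by
      intro d
      rw [norm_mul, Matrix.mul_apply]
      have h2 : ‖∑ c, P a c * X c d‖ ≤ ∑ c, mP * ‖X c d‖ :=
        (norm_sum_le _ _).trans (Finset.sum_le_sum fun c _ => by rw [norm_mul]; exact mul_le_mul_of_nonneg_right (hP a c) (norm_nonneg _))
      calc ‖∑ c, P a c * X c d‖ * ‖Q d b‖ ≤ (∑ c, mP * ‖X c d‖) * mQ :=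
            mul_le_mul h2 (hQ d b) (norm_nonneg _) (Finset.sum_nonneg fun c _ => mul_nonneg hmP (norm_nonneg _))
        _ = mQ * ∑ c, mP * ‖X c d‖ := by ring
    calc ∑ d, ‖(P * X) a d * Q d b‖ ≤ ∑ d, mQ * ∑ c, mP * ‖X c d‖ := Finset.sum_le_sum fun d _ => h1 d
      _ = mP * mQ * ∑ c, ∑ d, ‖X c d‖ := by
          rw [Finset.sum_comm]
          simp only [Finset.mul_sum]
          refine Finset.sum_congr rfl fun c _ => Finset.sum_congr rfl fun d _ => by ring
  calc ∑ a, ∑ b, ‖(P * X * Q) a b‖ ≤ ∑ _a : Fin 2, ∑ _b : Fin 2, mP * mQ * ∑ c, ∑ d, ‖X c d‖ :=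
        Finset.sum_le_sum fun a _ => Finset.sum_le_sum fun b _ => hentry a b
    _ = 4 * mP * mQ * ∑ a, ∑ b, ‖X a b‖ := by simp [Finset.sum_const, Finset.card_univ]; ring

/-! ## §2 Inverses: `U(J)` elements and the unitary stabiliser -/

/-- **entries of `G⁻¹` for `G ∈ U(J)`** are (± conjugates of) entries of `G` (★ `inv_eq_fromBlocks`), hence obey the same bound. [cite: Shimura1997, §5.1] -/
theorem norm_inv_apply_le_of_mem_UJ {G : Matrix (Fin 2 ⊕ Fin 2) (Fin 2 ⊕ Fin 2) ℂ} (hG : Gᴴ * Matrix.J (Fin 2) ℂ * G = Matrix.J (Fin 2) ℂ) {MG : ℝ}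
    (hGb : ∀ i j, ‖G i j‖ ≤ MG) (i j : Fin 2 ⊕ Fin 2) : ‖G⁻¹ i j‖ ≤ MG := by
  rw [inv_eq_fromBlocks hG]
  rcases i with i | i <;> rcases j with j | j
  · simpa [Matrix.toBlocks₂₂, Matrix.conjTranspose_apply] using hGb (Sum.inr j) (Sum.inr i)
  · simpa [Matrix.toBlocks₁₂, Matrix.conjTranspose_apply] using hGb (Sum.inl j) (Sum.inr i)
  · simpa [Matrix.toBlocks₂₁, Matrix.conjTranspose_apply] using hGb (Sum.inr j) (Sum.inl i)
  · simpa [Matrix.toBlocks₁₁, Matrix.conjTranspose_apply] using hGb (Sum.inl j) (Sum.inl i)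

/-- entries of a stabiliser element are `≤ 1` (it is unitary, ★ `mem_unitaryGroup_of_stab`). [cite: Shimura1997, §6.5] -/
theorem norm_apply_le_one_of_stab {u : Matrix (Fin 2 ⊕ Fin 2) (Fin 2 ⊕ Fin 2) ℂ} (hu : uᴴ * Matrix.J (Fin 2) ℂ * u = Matrix.J (Fin 2) ℂ)
    (huI : moeb u (I • (1 : Matrix (Fin 2) (Fin 2) ℂ)) = I • 1) (i j : Fin 2 ⊕ Fin 2) : ‖u i j‖ ≤ 1 :=
  entry_norm_bound_of_unitary (mem_unitaryGroup_of_stab hu huI) i j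

/-- … and so are the entries of `uᴴ = u⁻¹`. [cite: Shimura1997, §6.5] -/
theorem norm_conjTranspose_apply_le_one_of_stab {u : Matrix (Fin 2 ⊕ Fin 2) (Fin 2 ⊕ Fin 2) ℂ} (hu : uᴴ * Matrix.J (Fin 2) ℂ * u = Matrix.J (Fin 2) ℂ)
    (huI : moeb u (I • (1 : Matrix (Fin 2) (Fin 2) ℂ)) = I • 1) (i j : Fin 2 ⊕ Fin 2) : ‖uᴴ i j‖ ≤ 1 := by
  rw [conjTranspose_apply, norm_star]
  exact norm_apply_le_one_of_stab hu huI j i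

/-- `uᴴ u = 1` on the stabiliser. [cite: Shimura1997, §6.5] -/
theorem conjTranspose_mul_self_of_stab {u : Matrix (Fin 2 ⊕ Fin 2) (Fin 2 ⊕ Fin 2) ℂ} (hu : uᴴ * Matrix.J (Fin 2) ℂ * u = Matrix.J (Fin 2) ℂ)
    (huI : moeb u (I • (1 : Matrix (Fin 2) (Fin 2) ℂ)) = I • 1) : uᴴ * u = 1 := by
  have h := Matrix.mem_unitaryGroup_iff'.1 (mem_unitaryGroup_of_stab hu huI)
  rwa [star_eq_conjTranspose] at h

/-! ## §3 The letter `γ`: `C · y = R · γ` with `γ`, `γ⁻¹` bounded -/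

/-- **THE LEVI READING.**  Frame Levi `m₀ = diag(C, −B)` of `x = (0 B; C 0) ∈ U(J)`; reading `p·κ`, `p = (y b; 0 d)`, `κ·κ' = 1` with `‖κ‖, ‖κ'‖ ≤ M`; `G ∈ U(J)`, `‖G‖ ≤ M_G`;
hermitian Iwasawa decomposition `m₀·(p·κ·G) = n(X₀)·diag(R, R⁻¹)·u₀`, `u₀ ∈ Stab(i1)`.  THEN with `γ := (u₀·G⁻¹·κ')₁₁` and `γ' := (κ·G·u₀ᴴ)₁₁`:
`C·y = R·γ`, `γ'·γ = 1`, `γ·γ' = 1`, and every entry of `γ`, `γ'` is `≤ 16·M·M_G`. [cite: BorelJacquet1979, §4.1] [cite: Shimura1997, §18.1] -/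
theorem iwasawa_levi_reading {B C : Matrix (Fin 2) (Fin 2) ℂ}
    {G : Matrix (Fin 2 ⊕ Fin 2) (Fin 2 ⊕ Fin 2) ℂ} (hG : Gᴴ * Matrix.J (Fin 2) ℂ * G = Matrix.J (Fin 2) ℂ) {MG : ℝ} (hGb : ∀ i j, ‖G i j‖ ≤ MG)
    {κ κ' : Matrix (Fin 2 ⊕ Fin 2) (Fin 2 ⊕ Fin 2) ℂ} (hκκ' : κ * κ' = 1) {M : ℝ} (hκb : ∀ i j, ‖κ i j‖ ≤ M) (hκ'b : ∀ i j, ‖κ' i j‖ ≤ M)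
    {y b d : Matrix (Fin 2) (Fin 2) ℂ} {X₀ R : Matrix (Fin 2) (Fin 2) ℂ} {u₀ : Matrix (Fin 2 ⊕ Fin 2) (Fin 2 ⊕ Fin 2) ℂ}
    (hRu : IsUnit R.det) (hu₀ : u₀ᴴ * Matrix.J (Fin 2) ℂ * u₀ = Matrix.J (Fin 2) ℂ) (hu₀I : moeb u₀ (I • (1 : Matrix (Fin 2) (Fin 2) ℂ)) = I • 1)
    (hdec : (fromBlocks C 0 0 (-B) : Matrix (Fin 2 ⊕ Fin 2) (Fin 2 ⊕ Fin 2) ℂ) * ((fromBlocks y b 0 d : Matrix (Fin 2 ⊕ Fin 2) (Fin 2 ⊕ Fin 2) ℂ) * κ * G) =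
      fromBlocks 1 X₀ 0 1 * fromBlocks R 0 0 R⁻¹ * u₀) :
    C * y = R * (u₀ * G⁻¹ * κ').toBlocks₁₁ ∧ (κ * G * u₀ᴴ).toBlocks₁₁ * (u₀ * G⁻¹ * κ').toBlocks₁₁ = 1 ∧
      (u₀ * G⁻¹ * κ').toBlocks₁₁ * (κ * G * u₀ᴴ).toBlocks₁₁ = 1 ∧
      (∀ i j, ‖(u₀ * G⁻¹ * κ').toBlocks₁₁ i j‖ ≤ 16 * M * MG) ∧ (∀ i j, ‖(κ * G * u₀ᴴ).toBlocks₁₁ i j‖ ≤ 16 * M * MG) := by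
  have hGu : IsUnit G.det := isUnit_det_of_mem_UJ hG
  have hGG : G * G⁻¹ = 1 := Matrix.mul_nonsing_inv G hGu
  have huu : u₀ᴴ * u₀ = 1 := conjTranspose_mul_self_of_stab hu₀ hu₀I
  -- `n(X₀)·diag(R,R⁻¹)·W = m₀·p`
  have hW : fromBlocks 1 X₀ 0 1 * fromBlocks R 0 0 R⁻¹ * (u₀ * G⁻¹ * κ') =
      (fromBlocks C 0 0 (-B) : Matrix (Fin 2 ⊕ Fin 2) (Fin 2 ⊕ Fin 2) ℂ) * fromBlocks y b 0 d := by
    have h : (fromBlocks C 0 0 (-B) : Matrix (Fin 2 ⊕ Fin 2) (Fin 2 ⊕ Fin 2) ℂ) * ((fromBlocks y b 0 d : Matrix (Fin 2 ⊕ Fin 2) (Fin 2 ⊕ Fin 2) ℂ) * κ * G) *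
        (G⁻¹ * κ') = fromBlocks 1 X₀ 0 1 * fromBlocks R 0 0 R⁻¹ * u₀ * (G⁻¹ * κ') := by rw [hdec]
    calc fromBlocks 1 X₀ 0 1 * fromBlocks R 0 0 R⁻¹ * (u₀ * G⁻¹ * κ')
        = fromBlocks 1 X₀ 0 1 * fromBlocks R 0 0 R⁻¹ * u₀ * (G⁻¹ * κ') := by simp only [Matrix.mul_assoc]
      _ = (fromBlocks C 0 0 (-B) : Matrix (Fin 2 ⊕ Fin 2) (Fin 2 ⊕ Fin 2) ℂ) * (fromBlocks y b 0 d * (κ * (G * G⁻¹) * κ')) := by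
          rw [← h]; simp only [Matrix.mul_assoc]
      _ = (fromBlocks C 0 0 (-B) : Matrix (Fin 2 ⊕ Fin 2) (Fin 2 ⊕ Fin 2) ℂ) * fromBlocks y b 0 d := by
          rw [hGG, Matrix.mul_one, hκκ', Matrix.mul_one]
  -- multiply on the left by the inverse `diag(R⁻¹, R)·n(−X₀)` and read the blocks
  have hinv : (fromBlocks R⁻¹ 0 0 R * fromBlocks 1 (-X₀) 0 1 : Matrix (Fin 2 ⊕ Fin 2) (Fin 2 ⊕ Fin 2) ℂ) * (fromBlocks 1 X₀ 0 1 * fromBlocks R 0 0 R⁻¹) = 1 := by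
    rw [fromBlocks_multiply, fromBlocks_multiply, fromBlocks_multiply, ← fromBlocks_one]
    simp [Matrix.mul_assoc, Matrix.nonsing_inv_mul R hRu, Matrix.mul_nonsing_inv R hRu]
  have hWval : u₀ * G⁻¹ * κ' = (fromBlocks R⁻¹ 0 0 R * fromBlocks 1 (-X₀) 0 1 : Matrix (Fin 2 ⊕ Fin 2) (Fin 2 ⊕ Fin 2) ℂ) *
      ((fromBlocks C 0 0 (-B) : Matrix (Fin 2 ⊕ Fin 2) (Fin 2 ⊕ Fin 2) ℂ) * fromBlocks y b 0 d) := by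
    rw [← hW, ← Matrix.mul_assoc, hinv, Matrix.one_mul]
  have hW11 : (u₀ * G⁻¹ * κ').toBlocks₁₁ = R⁻¹ * (C * y) := by
    rw [hWval, fromBlocks_multiply, fromBlocks_multiply, fromBlocks_multiply, toBlocks_fromBlocks₁₁]
    simp
  have hW21 : (u₀ * G⁻¹ * κ').toBlocks₂₁ = 0 := by
    rw [hWval, fromBlocks_multiply, fromBlocks_multiply, fromBlocks_multiply, toBlocks_fromBlocks₂₁]
    simp
  -- `W'' · W = 1`, hence `γ'·γ = 1` (the `(2,1)` block of `W` vanishes)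
  have hWW : κ * G * u₀ᴴ * (u₀ * G⁻¹ * κ') = 1 := by
    calc κ * G * u₀ᴴ * (u₀ * G⁻¹ * κ') = κ * (G * ((u₀ᴴ * u₀) * G⁻¹)) * κ' := by simp only [Matrix.mul_assoc]
      _ = 1 := by rw [huu, Matrix.one_mul, hGG, Matrix.mul_one, hκκ']
  have hγ'γ : (κ * G * u₀ᴴ).toBlocks₁₁ * (u₀ * G⁻¹ * κ').toBlocks₁₁ = 1 := by
    have h := congrArg Matrix.toBlocks₁₁ hWW
    rw [← fromBlocks_toBlocks (κ * G * u₀ᴴ), ← fromBlocks_toBlocks (u₀ * G⁻¹ * κ'), fromBlocks_multiply, toBlocks_fromBlocks₁₁, hW21, Matrix.mul_zero,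
      add_zero, ← fromBlocks_one, toBlocks_fromBlocks₁₁] at h
    exact h
  refine ⟨?_, hγ'γ, mul_eq_one_comm.1 hγ'γ, ?_, ?_⟩
  · rw [hW11, ← Matrix.mul_assoc, Matrix.mul_nonsing_inv R hRu, Matrix.one_mul]
  · -- `W = (u₀ · G⁻¹) · κ'`: entries `≤ 4·(4·1·M_G)·M`
    have h1 : ∀ i j, ‖(u₀ * G⁻¹) i j‖ ≤ 4 * 1 * MG := norm_mul_apply_le_four (norm_apply_le_one_of_stab hu₀ hu₀I) (norm_inv_apply_le_of_mem_UJ hG hGb)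
    intro i j
    have h2 := norm_mul_apply_le_four h1 hκ'b (Sum.inl i) (Sum.inl j)
    calc ‖(u₀ * G⁻¹ * κ').toBlocks₁₁ i j‖ = ‖(u₀ * G⁻¹ * κ') (Sum.inl i) (Sum.inl j)‖ := rfl
      _ ≤ 4 * (4 * 1 * MG) * M := h2
      _ = 16 * M * MG := by ring
  · -- `W'' = (κ · G) · u₀ᴴ`: entries `≤ 4·(4·M·M_G)·1`
    have h1 : ∀ i j, ‖(κ * G) i j‖ ≤ 4 * M * MG := norm_mul_apply_le_four hκb hGb
    intro i j
    have h2 := norm_mul_apply_le_four h1 (norm_conjTranspose_apply_le_one_of_stab hu₀ hu₀I) (Sum.inl i) (Sum.inl j)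
    calc ‖(κ * G * u₀ᴴ).toBlocks₁₁ i j‖ = ‖(κ * G * u₀ᴴ) (Sum.inl i) (Sum.inl j)‖ := rfl
      _ ≤ 4 * (4 * M * MG) * 1 := h2
      _ = 16 * M * MG := by ring

/-! ## §4 HEAD — the six comparison inequalities -/

/-- **IWASAWA COMPARABILITY** (brick (3b)).  In the setting of §3 (frame `x = (0 B; C 0) ∈ U(J)` with Levi `m₀ = diag(C, −B)`, reading `p·κ` with `p = (y b; 0 d)`,
`κκ' = 1`, `‖κ‖, ‖κ'‖ ≤ M`, translate `G ∈ U(J)` with `‖G‖ ≤ M_G`, ANY hermitian Iwasawa decomposition `m₀·(p·κ·G) = n(X₀)·diag(R,R⁻¹)·u₀` with `Rᴴ = R` invertible and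
`u₀ ∈ Stab(i1)`) and for ANY index `hidx`, with `h₁ := C⁻ᴴ·hidx·C⁻¹` and `m := 16·M·M_G`:
`‖det C‖·‖det y‖ ≤ 2m²·‖det R‖`, `‖det R‖ ≤ 2m²·(‖det C‖·‖det y‖)`, `T₂(yᴴ·hidx·y) ≤ 4m²·T₂(R·h₁·R)`, `T₂(R·h₁·R) ≤ 4m²·T₂(yᴴ·hidx·y)`,
`‖det(yᴴ·hidx·y)‖ ≤ 4m⁴·‖det(R·h₁·R)‖`, `‖det(R·h₁·R)‖ ≤ 4m⁴·‖det(yᴴ·hidx·y)‖` (`T₂(X) = Σ_a Σ_b ‖X a b‖`) — from §3's `C·y = R·γ`: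
`yᴴ·hidx·y = γᴴ·(R h₁ R)·γ` and `R h₁ R = γ'ᴴ·(yᴴ hidx y)·γ'`. [cite: Shimura1997, §18.1] [cite: BorelJacquet1979, §4.1] -/
theorem iwasawa_comparability {B C : Matrix (Fin 2) (Fin 2) ℂ}
    (hx : (fromBlocks 0 B C 0 : Matrix (Fin 2 ⊕ Fin 2) (Fin 2 ⊕ Fin 2) ℂ)ᴴ * Matrix.J (Fin 2) ℂ * (fromBlocks 0 B C 0 : Matrix (Fin 2 ⊕ Fin 2) (Fin 2 ⊕ Fin 2) ℂ) =
      Matrix.J (Fin 2) ℂ)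
    {G : Matrix (Fin 2 ⊕ Fin 2) (Fin 2 ⊕ Fin 2) ℂ} (hG : Gᴴ * Matrix.J (Fin 2) ℂ * G = Matrix.J (Fin 2) ℂ) {MG : ℝ} (hGb : ∀ i j, ‖G i j‖ ≤ MG)
    {κ κ' : Matrix (Fin 2 ⊕ Fin 2) (Fin 2 ⊕ Fin 2) ℂ} (hκκ' : κ * κ' = 1) {M : ℝ} (hκb : ∀ i j, ‖κ i j‖ ≤ M) (hκ'b : ∀ i j, ‖κ' i j‖ ≤ M)
    {y b d : Matrix (Fin 2) (Fin 2) ℂ} {X₀ R : Matrix (Fin 2) (Fin 2) ℂ} {u₀ : Matrix (Fin 2 ⊕ Fin 2) (Fin 2 ⊕ Fin 2) ℂ}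
    (hR : Rᴴ = R) (hRu : IsUnit R.det) (hu₀ : u₀ᴴ * Matrix.J (Fin 2) ℂ * u₀ = Matrix.J (Fin 2) ℂ) (hu₀I : moeb u₀ (I • (1 : Matrix (Fin 2) (Fin 2) ℂ)) = I • 1)
    (hdec : (fromBlocks C 0 0 (-B) : Matrix (Fin 2 ⊕ Fin 2) (Fin 2 ⊕ Fin 2) ℂ) * ((fromBlocks y b 0 d : Matrix (Fin 2 ⊕ Fin 2) (Fin 2 ⊕ Fin 2) ℂ) * κ * G) =
      fromBlocks 1 X₀ 0 1 * fromBlocks R 0 0 R⁻¹ * u₀)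
    (hidx : Matrix (Fin 2) (Fin 2) ℂ) :
    ‖C.det‖ * ‖y.det‖ ≤ 2 * (16 * M * MG) ^ 2 * ‖R.det‖ ∧
      ‖R.det‖ ≤ 2 * (16 * M * MG) ^ 2 * (‖C.det‖ * ‖y.det‖) ∧
      (∑ a, ∑ b, ‖(yᴴ * hidx * y) a b‖) ≤ 4 * (16 * M * MG) ^ 2 * ∑ a, ∑ b, ‖(R * ((C⁻¹)ᴴ * hidx * C⁻¹) * R) a b‖ ∧
      (∑ a, ∑ b, ‖(R * ((C⁻¹)ᴴ * hidx * C⁻¹) * R) a b‖) ≤ 4 * (16 * M * MG) ^ 2 * ∑ a, ∑ b, ‖(yᴴ * hidx * y) a b‖ ∧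
      ‖(yᴴ * hidx * y).det‖ ≤ 4 * (16 * M * MG) ^ 4 * ‖(R * ((C⁻¹)ᴴ * hidx * C⁻¹) * R).det‖ ∧
      ‖(R * ((C⁻¹)ᴴ * hidx * C⁻¹) * R).det‖ ≤ 4 * (16 * M * MG) ^ 4 * ‖(yᴴ * hidx * y).det‖ := by
  obtain ⟨hCy, hγ'γ, hγγ', hγb, hγ'b⟩ := iwasawa_levi_reading hG hGb hκκ' hκb hκ'b hRu hu₀ hu₀I hdec
  set γ : Matrix (Fin 2) (Fin 2) ℂ := (u₀ * G⁻¹ * κ').toBlocks₁₁ with hγdef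
  set γ' : Matrix (Fin 2) (Fin 2) ℂ := (κ * G * u₀ᴴ).toBlocks₁₁ with hγ'def
  set m : ℝ := 16 * M * MG with hm
  -- `C` is invertible (`Cᴴ B = −1`)
  obtain ⟨hCB, -⟩ := antidiag_letters hx
  have hCu : IsUnit C.det := by
    have h := congrArg Matrix.det hCB
    rw [det_mul, det_conjTranspose, det_neg, det_one] at h
    refine isUnit_iff_ne_zero.2 fun h0 => ?_
    rw [h0, star_zero, zero_mul] at h
    have h4 : ((-1 : ℂ) ^ Fintype.card (Fin 2) * 1) = 1 := by simp
    rw [h4] at h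
    exact zero_ne_one h
  -- the two conjugation identities
  have hy : y = C⁻¹ * (R * γ) := by rw [← hCy, ← Matrix.mul_assoc, Matrix.nonsing_inv_mul C hCu, Matrix.one_mul]
  have hkey : yᴴ * hidx * y = γᴴ * (R * ((C⁻¹)ᴴ * hidx * C⁻¹) * R) * γ := by
    rw [hy, conjTranspose_mul, conjTranspose_mul, hR]
    simp only [Matrix.mul_assoc]
  have hkey' : R * ((C⁻¹)ᴴ * hidx * C⁻¹) * R = γ'ᴴ * (yᴴ * hidx * y) * γ' := by
    rw [hkey]
    calc R * ((C⁻¹)ᴴ * hidx * C⁻¹) * R = (γ * γ')ᴴ * (R * ((C⁻¹)ᴴ * hidx * C⁻¹) * R) * (γ * γ') := by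
          rw [hγγ', conjTranspose_one, Matrix.one_mul, Matrix.mul_one]
      _ = γ'ᴴ * (γᴴ * (R * ((C⁻¹)ᴴ * hidx * C⁻¹) * R) * γ) * γ' := by rw [conjTranspose_mul]; simp only [Matrix.mul_assoc]
  -- entry bounds for the conjugators and their determinants
  have hγHb : ∀ i j, ‖γᴴ i j‖ ≤ m := fun i j => by rw [conjTranspose_apply, norm_star]; exact hγb j i
  have hγ'Hb : ∀ i j, ‖γ'ᴴ i j‖ ≤ m := fun i j => by rw [conjTranspose_apply, norm_star]; exact hγ'b j i
  have hdγ : ‖γ.det‖ ≤ 2 * m ^ 2 := norm_det_fin_two_le hγb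
  have hdγ' : ‖γ'.det‖ ≤ 2 * m ^ 2 := norm_det_fin_two_le hγ'b
  have hm0 : 0 ≤ m := nonneg_of_entry_bound 0 hγb
  have h2m : 0 ≤ 2 * m ^ 2 := by positivity
  -- (1)(2) determinants of the Levi letters
  have hdet1 : ‖C.det‖ * ‖y.det‖ = ‖R.det‖ * ‖γ.det‖ := by rw [← norm_mul, ← det_mul, hCy, det_mul, norm_mul]
  have hR' : R = C * y * γ' := by rw [hCy, Matrix.mul_assoc, hγγ', Matrix.mul_one]
  have hdet2 : ‖R.det‖ = ‖C.det‖ * ‖y.det‖ * ‖γ'.det‖ := by rw [hR', det_mul, det_mul, norm_mul, norm_mul]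
  refine ⟨?_, ?_, ?_, ?_, ?_, ?_⟩
  · rw [hdet1]
    calc ‖R.det‖ * ‖γ.det‖ ≤ ‖R.det‖ * (2 * m ^ 2) := mul_le_mul_of_nonneg_left hdγ (norm_nonneg _)
      _ = 2 * m ^ 2 * ‖R.det‖ := by ring
  · rw [hdet2]
    calc ‖C.det‖ * ‖y.det‖ * ‖γ'.det‖ ≤ ‖C.det‖ * ‖y.det‖ * (2 * m ^ 2) := mul_le_mul_of_nonneg_left hdγ' (by positivity)
      _ = 2 * m ^ 2 * (‖C.det‖ * ‖y.det‖) := by ring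
  · -- (3) `T₂(yᴴ hidx y) ≤ 4m² T₂(R h₁ R)`
    rw [hkey]
    calc ∑ a, ∑ b, ‖(γᴴ * (R * ((C⁻¹)ᴴ * hidx * C⁻¹) * R) * γ) a b‖ ≤ 4 * m * m * ∑ a, ∑ b, ‖(R * ((C⁻¹)ᴴ * hidx * C⁻¹) * R) a b‖ :=
          entrySum_mul_mul_le hγHb hγb
      _ = 4 * m ^ 2 * ∑ a, ∑ b, ‖(R * ((C⁻¹)ᴴ * hidx * C⁻¹) * R) a b‖ := by ring
  · -- (4) `T₂(R h₁ R) ≤ 4m² T₂(yᴴ hidx y)`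
    rw [hkey']
    calc ∑ a, ∑ b, ‖(γ'ᴴ * (yᴴ * hidx * y) * γ') a b‖ ≤ 4 * m * m * ∑ a, ∑ b, ‖(yᴴ * hidx * y) a b‖ := entrySum_mul_mul_le hγ'Hb hγ'b
      _ = 4 * m ^ 2 * ∑ a, ∑ b, ‖(yᴴ * hidx * y) a b‖ := by ring
  · -- (5) determinants
    rw [hkey, det_mul, det_mul, det_conjTranspose, norm_mul, norm_mul, norm_star]
    calc ‖γ.det‖ * ‖(R * ((C⁻¹)ᴴ * hidx * C⁻¹) * R).det‖ * ‖γ.det‖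
        ≤ (2 * m ^ 2) * ‖(R * ((C⁻¹)ᴴ * hidx * C⁻¹) * R).det‖ * (2 * m ^ 2) := by
          refine mul_le_mul (mul_le_mul_of_nonneg_right hdγ (norm_nonneg _)) hdγ (norm_nonneg _) (mul_nonneg h2m (norm_nonneg _))
      _ = 4 * m ^ 4 * ‖(R * ((C⁻¹)ᴴ * hidx * C⁻¹) * R).det‖ := by ring
  · -- (6)
    rw [hkey', det_mul, det_mul, det_conjTranspose, norm_mul, norm_mul, norm_star]
    calc ‖γ'.det‖ * ‖(yᴴ * hidx * y).det‖ * ‖γ'.det‖ ≤ (2 * m ^ 2) * ‖(yᴴ * hidx * y).det‖ * (2 * m ^ 2) := by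
          refine mul_le_mul (mul_le_mul_of_nonneg_right hdγ' (norm_nonneg _)) hdγ' (norm_nonneg _) (mul_nonneg h2m (norm_nonneg _))
      _ = 4 * m ^ 4 * ‖(yᴴ * hidx * y).det‖ := by ring

end Summit.HodgeConjecture.HodgeConjecture.Cruxes.HLiu418.K2LiuKindWArchIwasawaComparability

end
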